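import Summits.SmoothPoincare4.SmoothPoincare4.Theses.WeakReductionDescent
import Summits.SmoothPoincare4.SmoothPoincare4.Theorems.WeakReductionDescentWeakReductionReducesStubLoopDichotomyFromFiveAux1
import Summits.SmoothPoincare4.SmoothPoincare4.Theorems.WeakReductionDescentWeakReductionReducesStubLoopDichotomyFromFiveCoreAux1

/-!
# Crux `WeakReductionReduces` (stmt-SmoothPoincare4-17908), line `loop_dichotomy`, stub CORE₄
# (`stub_loopDichotomyFourCore`) — normal form of the type: `k₀ ≥ 1` and `k₁ ≥ k₂` (proved glue)

Stub CORE₄ of skeleton v4 (lead seat c1; "Aranda–Zupan Thm 1.3, first sentence, at genus 4 for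
homotopy spheres"): a smooth homotopy 4-sphere `M` with an IRREDUCIBLE `(4; k)`-GK-trisection `T`,
`k₀ + k₁ + k₂ = 4`, all `kᵢ ≤ 2`, carrying a weak reduction with FIXED LABELS (`c` compressing in
`H₀ = T 1 ∩ T 2`, `c′` in `H₁ = T 0 ∩ T 2` and `H₂ = T 0 ∩ T 1`, disjoint, non-separating) has a
GK-trisection of genus `< 4` or is a loop surgery on a smooth `X` with a GK-trisection of genus `< 4`.

This file PROVES that CORE₄ follows from its restriction to the NORMALISED types
`(k₀; k₁, k₂) ∈ {(1; 2,1), (2; 1,1), (2; 2,0)}`, i.e. CORE₄ with the two extra hypotheses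
`1 ≤ k 0` and `k 2 ≤ k 1`:

* `k₀ ≥ 1` is a THEOREM: with the labels fixed, `c′` is a non-separating curve of the central
  surface compressing in both handlebodies of the Heegaard splitting `H₁ ∪_F H₂ = ∂(T 0)`, so
  `π₁(∂(T 0)) ≅ F_{k₀}` receives a non-trivial winding homomorphism and `k₀ ≠ 0` — the wave-2
  structural lemma `helper_one_le_kZero_of_doublyCompressing` (…StubLoopDichotomyFromFiveCoreAux1,
  PROVED from the tree's side functions of the two discs and (T2)/(T3) of Abrams–Gay–Kirby); in
  particular the type `(0; 2,2)` of CORE₄ is vacuous;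
* `k₁ ≥ k₂` is a relabelling: the transposition `(1 2)` of the sectors fixes `H₀` and swaps
  `H₁`, `H₂`, so it preserves the fixed-label form of the weak reduction (`c′` compresses in both),
  the type hypotheses, irreducibility (`isReducible_comp_perm`) and the two exits (which mention `M`
  only) — `IsGKTrisection.comp_perm`, `Literature.Barriers.SmoothPoincare4.Trisection.*_comp_perm`.

Registered helper `helper_loopDichotomyFourCore_of_normalised : CORE₄ⁿ → CORE₄` (stub-add on the
crux; lands `--supports stmt-SmoothPoincare4-17908`).  Pure logic over PROVED tree theorems.  What
remains of CORE₄ is CORE₄ⁿ, three types: `(1;2,1)` — `∂(T 0) = S¹ × S²` with its genus-4 splitting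
reduced by `c′`, `T 1 ≅ ♮²(S¹ × B³)`, `T 2 ≅ S¹ × B³`; `(2;1,1)` — `∂(T 0) = #²(S¹ × S²)`,
`T 1 ≅ T 2 ≅ S¹ × B³`; `(2;2,0)` — `∂(T 0) = #²(S¹ × S²)`, `T 2 ≅ B⁴` (so `∂(T 2) = H₀ ∪ H₁ ≅ S³`
carries the disjoint pair `c ⊂ H₀`-disc, `c′ ⊂ H₁`-disc: a weak reducing pair of the genus-4
splitting of `S³`).

## References

* R. Aranda, A. Zupan, *Manifolds with weakly reducible genus-three trisections are standard*,
  arXiv:2503.04607 (2025): Thm. 1.3 (p. 2), §2 (p. 6), §6 (pp. 20–21: "β₃ = γ₃ … k₃ = 1"). [ArandaZupan2025]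
* A. Abrams, D. Gay, R. Kirby, *Group trisections and smooth 4-manifolds*, Geom. Topol. 22 (2018),
  p. 1540. [AbramsGayKirby2018]
* D. Gay, R. Kirby, *Trisecting 4-manifolds*, Geom. Topol. 20 (2016), Def. 1. [GayKirby2016]
-/

-- the registered namespace `Summit.SmoothPoincare4.SmoothPoincare4.Theorems…` repeats a component
set_option linter.dupNamespace false

noncomputable section

open scoped Manifold ContDiff Topology ContinuousMap
open Set
open Literature.Topology.FourManifolds Literature.Topology.FourManifolds.Trisection

namespace Summit.SmoothPoincare4.SmoothPoincare4.Theorems.WeakReductionReduces.LoopDichotomy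

/-- **`helper_loopDichotomyFourCore_of_normalised` : CORE₄ⁿ → CORE₄** (registered helper of crux
stmt-SmoothPoincare4-17908, line `loop_dichotomy`, stub `stub_loopDichotomyFourCore`).  Given the
core for the normalised types (`1 ≤ k 0`, `k 2 ≤ k 1`), the core follows: `1 ≤ k 0` always holds
(`helper_one_le_kZero_of_doublyCompressing` applied to `c′` and its discs in `H₁`, `H₂`), and if
`k 1 < k 2` relabel the sectors by the transposition `(1 2)`, which fixes `H₀`, swaps `H₁` and
`H₂`, and preserves the type hypotheses, the fixed-label weak reduction, irreducibility and the two
exits. [cite: ArandaZupan2025, §2 (p. 6) and §6 (pp. 20–21)] [cite: AbramsGayKirby2018, p. 1540] -/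
theorem helper_loopDichotomyFourCore_of_normalised :
    (∀ (M : Type) [TopologicalSpace M] [T2Space M] [SecondCountableTopology M] [ChartedSpace (EuclideanSpace ℝ (Fin 4)) M] [IsManifold (𝓡 4) ((⊤ : ℕ∞) : WithTop ℕ∞) M], (M ≃ₕ (Metric.sphere (0 : EuclideanSpace ℝ (Fin 5)) 1)) → ∀ (k : Fin 3 → ℕ) (T : Fin 3 → Set M), Literature.Topology.FourManifolds.IsGKTrisection M 4 k T → k 0 + k 1 + k 2 = 4 → (∀ i, k i ≤ 2) → 1 ≤ k 0 → k 2 ≤ k 1 → (∃ c c' : Set M, Literature.Topology.FourManifolds.Trisection.IsCurve T c ∧ Literature.Topology.FourManifolds.Trisection.IsCurve T c' ∧ Disjoint c c' ∧ Literature.Topology.FourManifolds.Trisection.IsNonSeparating T c ∧ Literature.Topology.FourManifolds.Trisection.IsNonSeparating T c' ∧ Literature.Topology.FourManifolds.Trisection.BoundsDisc T (Literature.Topology.FourManifolds.Trisection.spineHandlebody T 0) c ∧ Literature.Topology.FourManifolds.Trisection.BoundsDisc T (Literature.Topology.FourManifolds.Trisection.spineHandlebody T 1) c' ∧ Literature.Topology.FourManifolds.Trisection.BoundsDisc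 T (Literature.Topology.FourManifolds.Trisection.spineHandlebody T 2) c') → ¬ Literature.Topology.FourManifolds.Trisection.IsReducible T → (∃ (g₁ : ℕ) (k₁ : Fin 3 → ℕ) (T₁ : Fin 3 → Set M), g₁ < 4 ∧ Literature.Topology.FourManifolds.IsGKTrisection M g₁ k₁ T₁) ∨ (∃ (X : Type) (_ : TopologicalSpace X) (_ : T2Space X) (_ : SecondCountableTopology X) (_ : ChartedSpace (EuclideanSpace ℝ (Fin 4)) X) (_ : IsManifold (𝓡 4) ((⊤ : ℕ∞) : WithTop ℕ∞) X) (g' : ℕ) (k' : Fin 3 → ℕ) (T' : Fin 3 → Set X) (ℓ : (Metric.sphere (0 : EuclideanSpace ℝ (Fin 2)) 1) → X), g' < 4 ∧ Literature.Topology.FourManifolds.IsGKTrisection X g' k' T' ∧ Manifold.IsSmoothEmbedding (𝓡 1) (𝓡 4) ((⊤ : ℕ∞) : WithTop ℕ∞) ℓ ∧ Literature.Topology.FourManifolds.IsCircleSurgery (𝓡 4) (𝓡 4) X M ℓ)) → ∀ (M : Type) [TopologicalSpace M] [T2Space M] [SecondCountableTopology M] [ChartedSpace (EuclideanSpace ℝ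 (Fin 4)) M] [IsManifold (𝓡 4) ((⊤ : ℕ∞) : WithTop ℕ∞) M], (M ≃ₕ (Metric.sphere (0 : EuclideanSpace ℝ (Fin 5)) 1)) → ∀ (k : Fin 3 → ℕ) (T : Fin 3 → Set M), Literature.Topology.FourManifolds.IsGKTrisection M 4 k T → k 0 + k 1 + k 2 = 4 → (∀ i, k i ≤ 2) → (∃ c c' : Set M, Literature.Topology.FourManifolds.Trisection.IsCurve T c ∧ Literature.Topology.FourManifolds.Trisection.IsCurve T c' ∧ Disjoint c c' ∧ Literature.Topology.FourManifolds.Trisection.IsNonSeparating T c ∧ Literature.Topology.FourManifolds.Trisection.IsNonSeparating T c' ∧ Literature.Topology.FourManifolds.Trisection.BoundsDisc T (Literature.Topology.FourManifolds.Trisection.spineHandlebody T 0) c ∧ Literature.Topology.FourManifolds.Trisection.BoundsDisc T (Literature.Topology.FourManifolds.Trisection.spineHandlebody T 1) c' ∧ Literature.Topology.FourManifolds.Trisection.BoundsDisc T (Literature.Topology.FourManifolds.Trisection.spineHandlebody T 2) c') → ¬ Literature.Topology.FourManifolds.Trisection.IsReducible T → (∃ (g₁ : ℕ) (k₁ : Fin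 3 → ℕ) (T₁ : Fin 3 → Set M), g₁ < 4 ∧ Literature.Topology.FourManifolds.IsGKTrisection M g₁ k₁ T₁) ∨ (∃ (X : Type) (_ : TopologicalSpace X) (_ : T2Space X) (_ : SecondCountableTopology X) (_ : ChartedSpace (EuclideanSpace ℝ (Fin 4)) X) (_ : IsManifold (𝓡 4) ((⊤ : ℕ∞) : WithTop ℕ∞) X) (g' : ℕ) (k' : Fin 3 → ℕ) (T' : Fin 3 → Set X) (ℓ : (Metric.sphere (0 : EuclideanSpace ℝ (Fin 2)) 1) → X), g' < 4 ∧ Literature.Topology.FourManifolds.IsGKTrisection X g' k' T' ∧ Manifold.IsSmoothEmbedding (𝓡 1) (𝓡 4) ((⊤ : ℕ∞) : WithTop ℕ∞) ℓ ∧ Literature.Topology.FourManifolds.IsCircleSurgery (𝓡 4) (𝓡 4) X M ℓ) := by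
  intro hcore M _ _ _ _ _ e k T hT hsum hk hwr hirr
  obtain ⟨c, c', hc, hc', hd, hn, hn', hb0, hb1, hb2⟩ := hwr
  have hk0 : 1 ≤ k 0 := helper_one_le_kZero_of_doublyCompressing M 4 k T hT c' hc' hn' hb1 hb2
  rcases le_or_gt (k 2) (k 1) with h21 | h12
  · exact hcore M e k T hT hsum hk hk0 h21 ⟨c, c', hc, hc', hd, hn, hn', hb0, hb1, hb2⟩ hirr
  · -- relabel by the transposition `(1 2)`
    set σ : Equiv.Perm (Fin 3) := Equiv.swap (1 : Fin 3) 2 with hσ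
    have hσ0 : σ 0 = 0 := by rw [hσ]; decide
    have hσ1 : σ 1 = 2 := by rw [hσ]; decide
    have hσ2 : σ 2 = 1 := by rw [hσ]; decide
    have hT' : IsGKTrisection M 4 (k ∘ σ) (T ∘ σ) := hT.comp_perm σ
    have hsum' : (k ∘ σ) 0 + (k ∘ σ) 1 + (k ∘ σ) 2 = 4 := by
      simp only [Function.comp_apply, hσ0, hσ1, hσ2]; omega
    have hk' : ∀ i, (k ∘ σ) i ≤ 2 := fun i => hk _
    have hk0' : 1 ≤ (k ∘ σ) 0 := by simp only [Function.comp_apply, hσ0]; exact hk0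
    have h21' : (k ∘ σ) 2 ≤ (k ∘ σ) 1 := by
      simp only [Function.comp_apply, hσ1, hσ2]; omega
    have hirr' : ¬ IsReducible (T ∘ σ) := fun h => hirr ((isReducible_comp_perm T σ).1 h)
    have hwr' : ∃ c c' : Set M, IsCurve (T ∘ σ) c ∧ IsCurve (T ∘ σ) c' ∧ Disjoint c c' ∧
        IsNonSeparating (T ∘ σ) c ∧ IsNonSeparating (T ∘ σ) c' ∧
        BoundsDisc (T ∘ σ) (spineHandlebody (T ∘ σ) 0) c ∧
        BoundsDisc (T ∘ σ) (spineHandlebody (T ∘ σ) 1) c' ∧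
        BoundsDisc (T ∘ σ) (spineHandlebody (T ∘ σ) 2) c' := by
      refine ⟨c, c', (Literature.Barriers.SmoothPoincare4.Trisection.isCurve_comp_perm T σ c).2 hc,
        (Literature.Barriers.SmoothPoincare4.Trisection.isCurve_comp_perm T σ c').2 hc', hd,
        (Literature.Barriers.SmoothPoincare4.Trisection.isNonSeparating_comp_perm T σ c).2 hn,
        (Literature.Barriers.SmoothPoincare4.Trisection.isNonSeparating_comp_perm T σ c').2 hn',
        ?_, ?_, ?_⟩
      · rw [Literature.Barriers.SmoothPoincare4.Trisection.spineHandlebody_comp_perm,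
          Literature.Barriers.SmoothPoincare4.Trisection.boundsDisc_comp_perm, hσ0]
        exact hb0
      · rw [Literature.Barriers.SmoothPoincare4.Trisection.spineHandlebody_comp_perm,
          Literature.Barriers.SmoothPoincare4.Trisection.boundsDisc_comp_perm, hσ1]
        exact hb2
      · rw [Literature.Barriers.SmoothPoincare4.Trisection.spineHandlebody_comp_perm,
          Literature.Barriers.SmoothPoincare4.Trisection.boundsDisc_comp_perm, hσ2]
        exact hb1
    exact hcore M e _ _ hT' hsum' hk' hk0' h21' hwr' hirr'

end Summit.SmoothPoincare4.SmoothPoincare4.Theorems.WeakReductionReduces.LoopDichotomy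

end
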